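import Summits.HodgeConjecture.CorCM.Census.DecicWeil23Pair
import Mathlib.GroupTheory.Perm.Basic
import HarnessLib

/-!
# TWO `(2,3)`-types over one DECIC CM field: the DEFECT LAW from `2`-TRANSITIVITY alone (no table) — an averaging argument over
# the fibres of a `2`-transitive, composition-closed set of realised permutations of the five conjugate pairs

COR-CM (cell `pub-hodgecm2`), seat b30 gen 23 (2026-08-22); count-neutral own lane DECIC-2T (gen 22's NEXT SIZED ITEM): the
`3`-transitivity hypothesis of the DECIC-WEIL-23PAIR chain (`Census/DecicWeil23Pair*`, `CorCM/DecicWeil23Pair*`: the totally real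
quintic `K⁺` has Galois group `A₅` or `S₅`) is weakened to `2`-TRANSITIVITY (`A₅`, `S₅` AND the Frobenius group `F₂₀` of order
`20`, which is sharply `2`-transitive and contains no even permutation table large enough for gen 22's proof).  Bookkeeping
definitions and theorems of the finite model; no named fact, no geometry, no `sorry`.

THE ARGUMENT (kernel, §1–§2).  Unknowns `e` (curve defect) and `d_{m,a}` (defect of the pair `a` on the factor of type `m`);
the equation realised by a permutation `π` of the pairs is `e + Σ_m Σ_a ε_m(π a) d_{m,a} = 0`, `ε_m(y) = +1` if `y ∈ I_m` and `−1`
otherwise (`sgnD`).  Let `R ⊆ Sym(5)` be closed under composition and `2`-TRANSITIVE (for `a ≠ b`, `x ≠ y` some `π ∈ R` has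
`π a = x`, `π b = y`).  Left translation by an element of `R` moving `(x, y)` to `(x', y')` injects the double fibre
`{π ∈ R | π b = x, π a = y}` into the one over `(x', y')`, so all double fibres off the diagonal have ONE size `n > 0`, and the
simple fibre `{π ∈ R | π b = x}` has `4n` elements (`a ≠ b` fixed, `y` running over the four values `≠ x`).  Summing the
equation over a simple fibre: `4n·e + Σ_m [4n ε_m(x) d_{m,b} + n Σ_{a ≠ b} (Σ_{y ≠ x} ε_m(y)) d_{m,a}] = 0`, and
`Σ_{y ≠ x} ε_m(y) = −1 − ε_m(x)` (two pairs inside `I_m`, three outside); dividing by `n`: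
`4e + Σ_m Σ_a (a = b ? 4ε_m(x) : −1 − ε_m(x)) · d_{m,a} = 0` for ALL `b, x` (`fourMul_add_sum_eq_zero_of_twoTransitive`).  Three
probes `x ∈ I_0 ∖ I_1`, `x ∈ I_1 ∖ I_0`, `x ∉ I_0 ∪ I_1` give `e = d_{0,b} + d_{1,b}` and `10 d_{m,b} = 2 Σ_a d_{m,a}`, i.e. THE
DEFECT LAW `d_{m,a} = d_{m,0}`, `e = d_{0,0} + d_{1,0}` (`defectD_of_signed_twoTransitive`) — the conclusion gen 22 drew from the
sixty tabulated even permutations (`defectD_of_signed`).  Conversely the defect law gives the equation at EVERY permutation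
(`signed_of_defectD`), in particular the sixty `A₅`-equations: a configuration balanced under a `2`-transitive composition-closed
`R` (`ModelBalancedP`, the type read through an arbitrary permutation: `phiP`) is balanced in gen 22's sense `ModelBalancedD`
(`modelBalancedD_of_modelBalancedP`, §3) — so the whole downstream chain (parts, extraction, sixfold/tenfold lemmas, assembly)
applies BY NAME.  (In representation-theoretic terms: the permutation module of a `2`-transitive group is `𝟙 ⊕ V` with `V`
irreducible, and the two centred sign vectors are independent; the first moments over point-stabiliser cosets already see this.)
[cite: DixonMortimer1996, Thm 7.6A] [cite: MoonenZarhin1995Duke, Thm. 2.4] [cite: GaoUllmo2025, Thm 3.1] [cite: Pohlmann1968, Thm 1]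

## References
* [DixonMortimer1996] J. D. Dixon, B. Mortimer, *Permutation Groups*, GTM 163 (1996), §2.1 and Thm 7.6A.  [MoonenZarhin1995Duke]
  B. Moonen, Yu. Zarhin, Duke Math. J. 77 (1995), Thm. 2.4.  [GaoUllmo2025] Z. Gao, E. Ullmo, J. Inst. Math. Jussieu 25 (2025),
  Thm 3.1.  [Pohlmann1968] H. Pohlmann, Ann. of Math. 88 (1968), Thm 1.

## Provenance
Exact python first (gen 22, `HOME/pub-hodgecm2-b30/decic-23pair/a5rows.py`, `multi_types.py`): the two-type system has nullity
`2` under all six conjugates of `F₂₀` (`540/540` ordered configurations) as under `A₅`/`S₅`; this file replaces the tables by the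
averaging argument, valid for every `2`-transitive composition-closed `R`.
-/

namespace Summit.HodgeConjecture.CorCM.Census.DecicWeil23Pair

open Finset

/-! ## §1 Signs and fibres -/

/-- The sign `ε_m(y) = ±1` of the pair `y` for the type `m`: `+1` iff `y ∈ I_m` (`inPos c m y`). [folklore] -/
def sgnD (c : Bool) (m : Fin 2) (y : Fin 5) : ℤ := if inPos c m y then 1 else -1

/-- `± t = ε_m(y) · t`. [folklore] -/
theorem ite_eq_sgnD_mul (c : Bool) (m : Fin 2) (y : Fin 5) (t : ℤ) :
    (if inPos c m y then t else -t) = sgnD c m y * t := by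
  unfold sgnD
  split_ifs <;> ring

/-- `Σ_y ε_m(y) = 2 − 3 = −1` (two of the five pairs lie in `I_m`). [folklore] -/
theorem sum_sgnD (c : Bool) (m : Fin 2) : ∑ y : Fin 5, sgnD c m y = -1 := by
  cases c <;> fin_cases m <;> simp [sgnD, inPos, Fin.sum_univ_five]

variable (R : Finset (Equiv.Perm (Fin 5)))

/-- **Left translation** by `h ∈ R` maps the double fibre `{π ∈ R | π b = x, π a = y}` injectively into the double fibre over
`(h x, h y)` (`R` closed under composition). [cite: DixonMortimer1996, §2.1] -/
theorem card_filter₂_le_of_mem (hmul : ∀ π₁ ∈ R, ∀ π₂ ∈ R, π₁ * π₂ ∈ R) {h : Equiv.Perm (Fin 5)} (hh : h ∈ R)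
    (b a x y : Fin 5) :
    (R.filter fun π => π b = x ∧ π a = y).card ≤ (R.filter fun π => π b = h x ∧ π a = h y).card := by
  refine Finset.card_le_card_of_injOn (fun π => h * π) (fun π hπ => ?_) (fun π₁ _ π₂ _ h12 => mul_left_cancel h12)
  rw [Finset.mem_coe, Finset.mem_filter] at hπ
  rw [Finset.mem_coe, Finset.mem_filter]
  exact ⟨hmul h hh π hπ.1, by rw [Equiv.Perm.mul_apply, hπ.2.1], by rw [Equiv.Perm.mul_apply, hπ.2.2]⟩

/-- **All off-diagonal double fibres have one size** (`R` closed under composition and `2`-transitive).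
[cite: DixonMortimer1996, §2.1] -/
theorem card_filter₂_eq (hmul : ∀ π₁ ∈ R, ∀ π₂ ∈ R, π₁ * π₂ ∈ R)
    (h2 : ∀ a b x y : Fin 5, a ≠ b → x ≠ y → ∃ π ∈ R, π a = x ∧ π b = y)
    (b a : Fin 5) {x y x' y' : Fin 5} (hxy : x ≠ y) (hxy' : x' ≠ y') :
    (R.filter fun π => π b = x ∧ π a = y).card = (R.filter fun π => π b = x' ∧ π a = y').card := by
  apply le_antisymm
  · obtain ⟨h, hh, hx, hy⟩ := h2 x y x' y' hxy hxy'
    have key := card_filter₂_le_of_mem R hmul hh b a x y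
    rwa [hx, hy] at key
  · obtain ⟨h, hh, hx, hy⟩ := h2 x' y' x y hxy' hxy
    have key := card_filter₂_le_of_mem R hmul hh b a x' y'
    rwa [hx, hy] at key

/-- The diagonal double fibres `{π | π b = x, π a = x}` are empty for `a ≠ b` (permutations are injective). [folklore] -/
theorem card_filter₂_diag {b a : Fin 5} (hab : a ≠ b) (x : Fin 5) :
    (R.filter fun π => π b = x ∧ π a = x).card = 0 := by
  rw [Finset.card_eq_zero, Finset.filter_eq_empty_iff]
  rintro π - ⟨hb, ha⟩
  exact hab (π.injective (ha.trans hb.symm))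

/-- The simple fibre `{π ∈ R | π b = x}` is the disjoint union over `y` of the double fibres. [folklore] -/
theorem card_filter_eq_sum_card_filter₂ (b a x : Fin 5) :
    (R.filter fun π => π b = x).card = ∑ y : Fin 5, (R.filter fun π => π b = x ∧ π a = y).card := by
  rw [Finset.card_eq_sum_card_fiberwise (f := fun π : Equiv.Perm (Fin 5) => π a) (t := univ)
    (fun _ _ => Finset.mem_coe.2 (Finset.mem_univ _))]
  refine Finset.sum_congr rfl fun y _ => ?_
  rw [Finset.filter_filter]

/-- Summing a function of `π a` over the simple fibre, fibrewise. [folklore] -/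
theorem sum_filter_apply_eq (b a x : Fin 5) (f : Fin 5 → ℤ) :
    ∑ π ∈ R.filter (fun π => π b = x), f (π a) =
      ∑ y : Fin 5, ((R.filter fun π => π b = x ∧ π a = y).card : ℤ) * f y := by
  rw [← Finset.sum_fiberwise' (R.filter fun π => π b = x) (fun π : Equiv.Perm (Fin 5) => π a) f]
  refine Finset.sum_congr rfl fun y _ => ?_
  rw [Finset.sum_const, Finset.filter_filter, nsmul_eq_mul]

/-! ## §2 The averaged equation and the defect law -/

/-- **THE AVERAGED EQUATION.**  If `R` is closed under composition and `2`-transitive and the signed equation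
`e + Σ_m Σ_a ε_m(π a) d_{m,a} = 0` holds at every `π ∈ R`, then for all pairs `b, x`:
`4e + Σ_m Σ_a (a = b ? 4ε_m(x) : −1 − ε_m(x)) · d_{m,a} = 0` (sum the equation over the fibre `{π ∈ R | π b = x}`, of size `4n`
where `n > 0` is the common size of the off-diagonal double fibres, and divide by `n`). [cite: DixonMortimer1996, §2.1]
[cite: MoonenZarhin1995Duke, Thm. 2.4] -/
theorem fourMul_add_sum_eq_zero_of_twoTransitive (c : Bool) (hmul : ∀ π₁ ∈ R, ∀ π₂ ∈ R, π₁ * π₂ ∈ R)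
    (h2 : ∀ a b x y : Fin 5, a ≠ b → x ≠ y → ∃ π ∈ R, π a = x ∧ π b = y) (e : ℤ) (d : Fin 2 → Fin 5 → ℤ)
    (h : ∀ π ∈ R, e + ∑ m : Fin 2, ∑ a : Fin 5, sgnD c m (π a) * d m a = 0) (b x : Fin 5) :
    4 * e + ∑ m : Fin 2, ∑ a : Fin 5, (if a = b then 4 * sgnD c m x else -1 - sgnD c m x) * d m a = 0 := by
  -- an auxiliary pair `a₀ ≠ b` and value `y₀ ≠ x`; `n` = the size of the double fibre over `(x, y₀)`
  obtain ⟨a₀, ha₀⟩ := exists_ne b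
  obtain ⟨y₀, hy₀⟩ := exists_ne x
  set F : Finset (Equiv.Perm (Fin 5)) := R.filter fun π => π b = x with hF
  set n : ℕ := (R.filter fun π => π b = x ∧ π a₀ = y₀).card with hn
  -- the simple fibre has `4 ·` (any off-diagonal double fibre) elements
  have hfib : ∀ a, a ≠ b → ∀ y₁, y₁ ≠ x → F.card = 4 * (R.filter fun π => π b = x ∧ π a = y₁).card := by
    intro a ha y₁ hy₁
    rw [hF, card_filter_eq_sum_card_filter₂ R b a x, ← Finset.sum_erase_add _ _ (Finset.mem_univ x),
      card_filter₂_diag R ha x, add_zero]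
    have hc : ∀ y ∈ (univ : Finset (Fin 5)).erase x, (R.filter fun π => π b = x ∧ π a = y).card =
        (R.filter fun π => π b = x ∧ π a = y₁).card := fun y hy =>
      card_filter₂_eq R hmul h2 b a (Finset.ne_of_mem_erase hy).symm hy₁.symm
    rw [Finset.sum_congr rfl hc, Finset.sum_const, smul_eq_mul, Finset.card_erase_of_mem (Finset.mem_univ x),
      Finset.card_univ, Fintype.card_fin]
  have hN : F.card = 4 * n := hfib a₀ ha₀ y₀ hy₀
  have hn₂ : ∀ a, a ≠ b → ∀ y, y ≠ x → (R.filter fun π => π b = x ∧ π a = y).card = n := by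
    intro a ha y hy
    have h1 := hfib a ha y hy
    omega
  have hpos : 0 < n := by
    obtain ⟨π, hπ, hb, ha⟩ := h2 b a₀ x y₀ ha₀.symm hy₀.symm
    exact Finset.card_pos.2 ⟨π, Finset.mem_filter.2 ⟨hπ, hb, ha⟩⟩
  -- sum the equation over the simple fibre
  have hsum : ∑ π ∈ F, (e + ∑ m : Fin 2, ∑ a : Fin 5, sgnD c m (π a) * d m a) = 0 :=
    Finset.sum_eq_zero fun π hπ => h π (Finset.mem_filter.1 hπ).1
  have hswap : ∑ π ∈ F, ∑ m : Fin 2, ∑ a : Fin 5, sgnD c m (π a) * d m a =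
      ∑ m : Fin 2, ∑ a : Fin 5, (∑ π ∈ F, sgnD c m (π a)) * d m a := by
    rw [Finset.sum_comm]
    refine Finset.sum_congr rfl fun m _ => ?_
    rw [Finset.sum_comm]
    refine Finset.sum_congr rfl fun a _ => ?_
    rw [Finset.sum_mul]
  -- the inner sums over the fibre
  have hinner : ∀ (m : Fin 2) (a : Fin 5), ∑ π ∈ F, sgnD c m (π a) =
      if a = b then (4 * n : ℤ) * sgnD c m x else (n : ℤ) * (-1 - sgnD c m x) := by
    intro m a
    by_cases hab : a = b
    · rw [if_pos hab, hab, Finset.sum_congr rfl fun π hπ => by rw [(Finset.mem_filter.1 hπ).2], Finset.sum_const,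
        nsmul_eq_mul, hN]
      push_cast
      ring
    · rw [if_neg hab, hF, sum_filter_apply_eq R b a x (sgnD c m), ← Finset.sum_erase_add _ _ (Finset.mem_univ x),
        card_filter₂_diag R hab x, Nat.cast_zero, zero_mul, add_zero,
        Finset.sum_congr rfl fun y hy => by rw [hn₂ a hab y (Finset.ne_of_mem_erase hy)], ← Finset.mul_sum,
        Finset.sum_erase_eq_sub (Finset.mem_univ x), sum_sgnD]
  rw [Finset.sum_add_distrib, Finset.sum_const, nsmul_eq_mul, hswap,
    Finset.sum_congr rfl fun m _ => Finset.sum_congr rfl fun a _ => by rw [hinner m a], hN] at hsum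
  -- factor `n`
  have hfactor : ((4 * n : ℕ) : ℤ) * e +
      ∑ m : Fin 2, ∑ a : Fin 5, (if a = b then (4 * n : ℤ) * sgnD c m x else (n : ℤ) * (-1 - sgnD c m x)) * d m a =
      (n : ℤ) * (4 * e + ∑ m : Fin 2, ∑ a : Fin 5, (if a = b then 4 * sgnD c m x else -1 - sgnD c m x) * d m a) := by
    rw [mul_add, Finset.mul_sum]
    push_cast
    congr 1
    · ring
    · refine Finset.sum_congr rfl fun m _ => ?_
      rw [Finset.mul_sum]
      refine Finset.sum_congr rfl fun a _ => ?_
      split_ifs <;> ring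
  rw [hfactor] at hsum
  exact (mul_eq_zero.1 hsum).resolve_left (by exact_mod_cast hpos.ne')

/-- **THE DEFECT LAW FROM `2`-TRANSITIVITY.**  For `R ⊆ Sym(5)` closed under composition and `2`-transitive, the signed
equations `e + Σ_{m,a} ± d_{m,a} = 0` (sign `+` iff `π a ∈ I_m`) at all `π ∈ R` force `d_{m,a} = d_{m,0}` for all `m, a` AND
`e = d_{0,0} + d_{1,0}` — the conclusion of gen 22's `defectD_of_signed` (sixty even permutations), now for `A₅`, `S₅` and the
six Frobenius groups `F₂₀` alike, without a table. [cite: MoonenZarhin1995Duke, Thm. 2.4] [cite: GaoUllmo2025, Thm 3.1]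
[cite: DixonMortimer1996, §2.1] -/
theorem defectD_of_signed_twoTransitive (c : Bool) (hmul : ∀ π₁ ∈ R, ∀ π₂ ∈ R, π₁ * π₂ ∈ R)
    (h2 : ∀ a b x y : Fin 5, a ≠ b → x ≠ y → ∃ π ∈ R, π a = x ∧ π b = y) (e : ℤ) (d : Fin 2 → Fin 5 → ℤ)
    (h : ∀ π ∈ R, e + ∑ m : Fin 2, ∑ a : Fin 5, (if inPos c m (π a) then d m a else -d m a) = 0) :
    (∀ (m : Fin 2) (a : Fin 5), d m a = d m 0) ∧ e = d 0 0 + d 1 0 := by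
  have h' : ∀ π ∈ R, e + ∑ m : Fin 2, ∑ a : Fin 5, sgnD c m (π a) * d m a = 0 := by
    intro π hπ
    rw [← h π hπ]
    simp only [ite_eq_sgnD_mul]
  have key := fourMul_add_sum_eq_zero_of_twoTransitive R c hmul h2 e d h'
  -- `Σ_a (a = b ? α : β) · f a = (α − β) f b + β Σ_a f a`
  have hsum_ite : ∀ (b : Fin 5) (α β : ℤ) (f : Fin 5 → ℤ),
      ∑ a : Fin 5, (if a = b then α else β) * f a = (α - β) * f b + β * ∑ a : Fin 5, f a := by
    intro b α β f
    rw [Finset.sum_congr rfl fun a _ => show (if a = b then α else β) * f a =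
      (if a = b then (α - β) * f a else 0) + β * f a by split_ifs <;> ring, Finset.sum_add_distrib,
      Finset.sum_ite_eq' Finset.univ b, if_pos (Finset.mem_univ b), ← Finset.mul_sum]
  -- three probes: `x₀ ∈ I_0 ∖ I_1`, `x₁ ∈ I_1 ∖ I_0`, `x₂ ∉ I_0 ∪ I_1`
  obtain ⟨x₀, x₁, x₂, hs00, hs10, hs01, hs11, hs02, hs12⟩ : ∃ x₀ x₁ x₂ : Fin 5, sgnD c 0 x₀ = 1 ∧ sgnD c 1 x₀ = -1 ∧
      sgnD c 0 x₁ = -1 ∧ sgnD c 1 x₁ = 1 ∧ sgnD c 0 x₂ = -1 ∧ sgnD c 1 x₂ = -1 := by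
    cases c
    · exact ⟨0, 2, 4, by decide⟩
    · exact ⟨0, 2, 3, by decide⟩
  have p0 : ∀ b, 4 * e + (6 * d 0 b - 2 * ∑ a : Fin 5, d 0 a) - 4 * d 1 b = 0 := fun b => by
    have hb := key b x₀
    rw [Fin.sum_univ_two, hsum_ite, hsum_ite, hs00, hs10] at hb
    linarith
  have p1 : ∀ b, 4 * e - 4 * d 0 b + (6 * d 1 b - 2 * ∑ a : Fin 5, d 1 a) = 0 := fun b => by
    have hb := key b x₁
    rw [Fin.sum_univ_two, hsum_ite, hsum_ite, hs01, hs11] at hb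
    linarith
  have p2 : ∀ b, 4 * e - 4 * d 0 b - 4 * d 1 b = 0 := fun b => by
    have hb := key b x₂
    rw [Fin.sum_univ_two, hsum_ite, hsum_ite, hs02, hs12] at hb
    linarith
  -- hence `5 d_{m,b} = Σ_a d_{m,a}` for both `m`, and `e = d_{0,b} + d_{1,b}`
  have hd : ∀ (m : Fin 2) (b : Fin 5), 5 * d m b = ∑ a : Fin 5, d m a := by
    refine Fin.forall_fin_two.2 ⟨fun b => ?_, fun b => ?_⟩
    · have h₁ := p0 b; have h₂ := p2 b; linarith
    · have h₁ := p1 b; have h₂ := p2 b; linarith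
  refine ⟨fun m a => ?_, by have h₁ := p2 0; linarith⟩
  have h₁ := hd m a; have h₂ := hd m 0
  linarith

/-- **Conversely, the defect law gives the signed equation at EVERY permutation of the pairs** (`Σ_a ε_m(π a) = Σ_y ε_m(y) = −1`).
[folklore] -/
theorem signed_of_defectD (c : Bool) (π : Equiv.Perm (Fin 5)) {e : ℤ} {d : Fin 2 → Fin 5 → ℤ}
    (hd : ∀ (m : Fin 2) (a : Fin 5), d m a = d m 0) (he : e = d 0 0 + d 1 0) :
    e + ∑ m : Fin 2, ∑ a : Fin 5, (if inPos c m (π a) then d m a else -d m a) = 0 := by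
  have key : ∀ m : Fin 2, ∑ a : Fin 5, (if inPos c m (π a) then d m a else -d m a) = -d m 0 := by
    intro m
    rw [Finset.sum_congr rfl fun a _ => by rw [hd m a, ite_eq_sgnD_mul], ← Finset.sum_mul,
      Equiv.sum_comp π (sgnD c m), sum_sgnD]
    ring
  rw [Fin.sum_univ_two, key, key, he]
  ring

/-! ## §3 The type read through an arbitrary permutation; `R`-balanced configurations are `A₅`-balanced -/

/-- **`π⁻¹(type)` read in the model**, for an ARBITRARY permutation `π` of the five pairs (Boolean form): the curve point of sign
`b` belongs iff `b`; the point `(m, a, b)` iff `b = [π a ∈ I_m]`. [cite: GaoUllmo2025, Thm 3.1 (3.2)] -/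
def inPhiP (c : Bool) (π : Fin 5 → Fin 5) : PtD → Bool
  | Sum.inl b => b
  | Sum.inr (m, (a, b)) => b == inPos c m (π a)

/-- `π⁻¹(type)` as a finset of the model. [cite: GaoUllmo2025, Thm 3.1 (3.2)] -/
def phiP (c : Bool) (π : Fin 5 → Fin 5) : Finset PtD := univ.filter fun y => inPhiP c π y = true

/-- Membership, curve slot. [folklore] -/
theorem inl_mem_phiP (c : Bool) (π : Fin 5 → Fin 5) (b : Bool) : Sum.inl b ∈ phiP c π ↔ b = true := by
  simp [phiP, inPhiP]

/-- Membership, fivefold slots. [folklore] -/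
theorem inr_mem_phiP (c : Bool) (π : Fin 5 → Fin 5) (m : Fin 2) (a : Fin 5) (b : Bool) :
    Sum.inr (m, (a, b)) ∈ phiP c π ↔ b = inPos c m (π a) := by
  simp [phiP, inPhiP]

/-- The sixty table rows of `Census/DecicWeil23Pair` are the case `π = permD r`: `phiD c r = phiP c (permD r)`. [folklore] -/
theorem phiD_eq_phiP (c : Bool) (r : Fin 60) : phiD c r = phiP c (permD r) := by
  ext y
  rcases y with b | ⟨m, a, b⟩
  · rw [inl_mem_phiD, inl_mem_phiP]
  · rw [inr_mem_phiD, inr_mem_phiP]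
    exact Iff.rfl

/-- `phiP c π` as an explicit finset: `{inl true} ⊔ {inr (m, (a, [π a ∈ I_m]))}`. [folklore] -/
theorem phiP_eq (c : Bool) (π : Fin 5 → Fin 5) : phiP c π =
    insert (Sum.inl true) ((univ : Finset (Fin 2 × Fin 5)).image fun q => (Sum.inr (q.1, (q.2, inPos c q.1 (π q.2))) : PtD)) := by
  ext y
  rw [Finset.mem_insert, Finset.mem_image]
  rcases y with b | ⟨m, a, b⟩
  · rw [inl_mem_phiP]
    constructor
    · rintro rfl
      exact Or.inl rfl
    · rintro (h | ⟨q, -, hq⟩)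
      · exact Sum.inl_injective h
      · exact absurd hq Sum.inr_ne_inl
  · rw [inr_mem_phiP]
    constructor
    · rintro rfl
      exact Or.inr ⟨(m, a), Finset.mem_univ _, rfl⟩
    · rintro (h | ⟨⟨m', a'⟩, -, hq⟩)
      · exact absurd h Sum.inr_ne_inl
      · simp only [Sum.inr.injEq, Prod.mk.injEq] at hq
        obtain ⟨rfl, rfl, rfl⟩ := hq
        rfl

/-- The sum over `phiP c π`, expanded. [folklore] -/
theorem sum_phiP (c : Bool) (π : Fin 5 → Fin 5) (N : PtD → ℕ) :
    ∑ y ∈ phiP c π, N y = N (Sum.inl true) + ∑ m : Fin 2, ∑ a : Fin 5, N (Sum.inr (m, (a, inPos c m (π a)))) := by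
  rw [phiP_eq c π]
  have hinj : Function.Injective fun q : Fin 2 × Fin 5 => (Sum.inr (q.1, (q.2, inPos c q.1 (π q.2))) : PtD) := by
    rintro ⟨m, a⟩ ⟨m', a'⟩ h
    simp only [Sum.inr.injEq, Prod.mk.injEq] at h
    obtain ⟨rfl, rfl, -⟩ := h
    rfl
  have h1 : Sum.inl true ∉ (univ : Finset (Fin 2 × Fin 5)).image
      fun q => (Sum.inr (q.1, (q.2, inPos c q.1 (π q.2))) : PtD) := by simp
  rw [Finset.sum_insert h1, Finset.sum_image fun q _ q' _ h => hinj h, Fintype.sum_prod_type]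

/-- **The signed form of the balance equation at `π`**: `2 Σ_{y ∈ phiP c π} N y = Σ_y N y` iff
`(N t − N f) + Σ_{m,a} ± (N(m,a,t) − N(m,a,f)) = 0`, the sign being `+` iff `π a ∈ I_m`. [cite: GaoUllmo2025, Thm 3.1] -/
theorem balancedP_iff_signed (c : Bool) (π : Fin 5 → Fin 5) (N : PtD → ℕ) :
    2 * ∑ y ∈ phiP c π, N y = ∑ y : PtD, N y ↔
      ((N (Sum.inl true) : ℤ) - N (Sum.inl false)) + ∑ m : Fin 2, ∑ a : Fin 5,
        (if inPos c m (π a) then ((N (Sum.inr (m, (a, true))) : ℤ) - N (Sum.inr (m, (a, false))))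
          else -(((N (Sum.inr (m, (a, true))) : ℤ) - N (Sum.inr (m, (a, false)))))) = 0 := by
  rw [sum_phiP, sum_ptD]
  have key : ∀ m a, (2 * (N (Sum.inr (m, (a, inPos c m (π a)))) : ℤ)) =
      ((N (Sum.inr (m, (a, true))) : ℤ) + N (Sum.inr (m, (a, false)))) +
        (if inPos c m (π a) then ((N (Sum.inr (m, (a, true))) : ℤ) - N (Sum.inr (m, (a, false))))
          else -(((N (Sum.inr (m, (a, true))) : ℤ) - N (Sum.inr (m, (a, false)))))) := by
    intro m a
    cases inPos c m (π a) <;> simp <;> ring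
  have hsum : (2 * (∑ m : Fin 2, ∑ a : Fin 5, N (Sum.inr (m, (a, inPos c m (π a))))) : ℤ) =
      (∑ m : Fin 2, ∑ a : Fin 5, (((N (Sum.inr (m, (a, true))) : ℤ) + N (Sum.inr (m, (a, false)))))) +
        ∑ m : Fin 2, ∑ a : Fin 5,
          (if inPos c m (π a) then ((N (Sum.inr (m, (a, true))) : ℤ) - N (Sum.inr (m, (a, false))))
            else -(((N (Sum.inr (m, (a, true))) : ℤ) - N (Sum.inr (m, (a, false)))))) := by
    push_cast
    rw [Finset.mul_sum, ← Finset.sum_add_distrib]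
    refine Finset.sum_congr rfl fun m _ => ?_
    rw [Finset.mul_sum, ← Finset.sum_add_distrib]
    refine Finset.sum_congr rfl fun a _ => ?_
    exact key m a
  constructor
  · intro h
    have hz : (2 : ℤ) * ((N (Sum.inl true) : ℤ) + ((∑ m : Fin 2, ∑ a : Fin 5, N (Sum.inr (m, (a, inPos c m (π a)))) : ℕ) : ℤ)) =
        (N (Sum.inl true) : ℤ) + N (Sum.inl false) +
          ((∑ m : Fin 2, ∑ a : Fin 5, (N (Sum.inr (m, (a, true))) + N (Sum.inr (m, (a, false)))) : ℕ) : ℤ) := by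
      exact_mod_cast h
    push_cast at hz hsum
    linarith
  · intro h
    have hz : (2 : ℤ) * ((N (Sum.inl true) : ℤ) + ((∑ m : Fin 2, ∑ a : Fin 5, N (Sum.inr (m, (a, inPos c m (π a)))) : ℕ) : ℤ)) =
        (N (Sum.inl true) : ℤ) + N (Sum.inl false) +
          ((∑ m : Fin 2, ∑ a : Fin 5, (N (Sum.inr (m, (a, true))) + N (Sum.inr (m, (a, false)))) : ℕ) : ℤ) := by
      push_cast at hsum ⊢
      linarith
    exact_mod_cast hz

variable {α : Type*}

/-- **Balanced configurations under a set `R` of realised permutations**: for every `π ∈ R` the equation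
`2 · #{x ∈ T | v x ∈ π⁻¹(type)} = |T|`. [cite: GaoUllmo2025, Thm 3.1 eq. (3.2)] [cite: Pohlmann1968, Thm 1] -/
def ModelBalancedP (c : Bool) (R : Finset (Equiv.Perm (Fin 5))) (v : α → PtD) (T : Finset α) : Prop :=
  ∀ π ∈ R, 2 * (T.filter fun x => v x ∈ phiP c π).card = T.card

variable {R} {c : Bool} {v : α → PtD}

/-- **The defect law of fibre counts balanced under `R`** (`R` closed under composition and `2`-transitive).
[cite: MoonenZarhin1995Duke, Thm. 2.4] [cite: GaoUllmo2025, Thm 3.1] -/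
theorem defect_of_balancedP (hmul : ∀ π₁ ∈ R, ∀ π₂ ∈ R, π₁ * π₂ ∈ R)
    (h2 : ∀ a b x y : Fin 5, a ≠ b → x ≠ y → ∃ π ∈ R, π a = x ∧ π b = y) (N : PtD → ℕ)
    (hN : ∀ π ∈ R, 2 * ∑ y ∈ phiP c π, N y = ∑ y : PtD, N y) :
    (∀ (m : Fin 2) (a : Fin 5), (N (Sum.inr (m, (a, true))) : ℤ) - N (Sum.inr (m, (a, false))) =
        (N (Sum.inr (m, (0, true))) : ℤ) - N (Sum.inr (m, (0, false)))) ∧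
      (N (Sum.inl true) : ℤ) - N (Sum.inl false) = (N (Sum.inr (0, (0, true))) : ℤ) - N (Sum.inr (0, (0, false))) +
        ((N (Sum.inr (1, (0, true))) : ℤ) - N (Sum.inr (1, (0, false)))) :=
  defectD_of_signed_twoTransitive R c hmul h2 _ (fun m a => (N (Sum.inr (m, (a, true))) : ℤ) - N (Sum.inr (m, (a, false))))
    fun π hπ => (balancedP_iff_signed c π N).1 (hN π hπ)

/-- **`R`-BALANCED ⟹ `A₅`-BALANCED.**  If `R` is closed under composition and `2`-transitive, a configuration balanced under `R`
satisfies all sixty equations `ModelBalancedD` of `Census/DecicWeil23Pair` (defect law from `2`-transitivity, then the signed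
equation at every even permutation) — so gen 22's parts / extraction / induction apply verbatim. [cite: MoonenZarhin1995Duke, Thm. 2.4]
[cite: GaoUllmo2025, Thm 3.1] -/
theorem modelBalancedD_of_modelBalancedP (hmul : ∀ π₁ ∈ R, ∀ π₂ ∈ R, π₁ * π₂ ∈ R)
    (h2 : ∀ a b x y : Fin 5, a ≠ b → x ≠ y → ∃ π ∈ R, π a = x ∧ π b = y) {T : Finset α}
    (hT : ModelBalancedP c R v T) : ModelBalancedD c v T := by
  obtain ⟨hd, he⟩ := defect_of_balancedP hmul h2 (fun y => (T.filter fun x => v x = y).card) fun π hπ => by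
    rw [← card_filter_mem_eq_sumD, ← card_eq_sumD v T]; exact hT π hπ
  intro r
  rw [card_filter_mem_eq_sumD, card_eq_sumD v T, balancedD_iff_signed]
  -- the `r`-th even permutation as an element of `Sym(5)`: `signTabD c r m a = inPos c m (permD r a)`
  exact signed_of_defectD c (Equiv.ofBijective (permD r) (Finite.injective_iff_bijective.1 (permD_facts.1 r))) hd he

/-- **… and is then balanced at EVERY permutation of the pairs** (not only the sixty even ones). [folklore] -/
theorem balancedP_of_modelBalancedP (hmul : ∀ π₁ ∈ R, ∀ π₂ ∈ R, π₁ * π₂ ∈ R)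
    (h2 : ∀ a b x y : Fin 5, a ≠ b → x ≠ y → ∃ π ∈ R, π a = x ∧ π b = y) {T : Finset α}
    (hT : ModelBalancedP c R v T) (π : Equiv.Perm (Fin 5)) : 2 * (T.filter fun x => v x ∈ phiP c π).card = T.card := by
  obtain ⟨hd, he⟩ := defect_of_balancedP hmul h2 (fun y => (T.filter fun x => v x = y).card) fun π hπ => by
    rw [← card_filter_mem_eq_sumD, ← card_eq_sumD v T]; exact hT π hπ
  rw [card_filter_mem_eq_sumD, card_eq_sumD v T, balancedP_iff_signed]
  exact signed_of_defectD c π hd he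

end Summit.HodgeConjecture.CorCM.Census.DecicWeil23Pair
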